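import Mathlib
import Literature.Analysis.FluidPDE.ClassicalSolution
import Literature.Analysis.FluidPDE.AxisymmetricEuler
import Literature.Analysis.FluidPDE.SwirlTransportProofs
import Literature.Analysis.FluidPDE.AxisymmetricVorticityTransport
import Literature.Analysis.FluidPDE.VorticityCalculus
import Summits.NavierStokesRegularity.NavierStokesRegularity.Theorems.ThreadingFluxHorizonTowerDefs
import HarnessLib

/-!
# Crux `PoloidalLiouville` (stmt-NavierStokesRegularity-1222, W1), crux idea «precession-gap» (ns-idea-15):
# PRECESSING HORIZON EQUIVARIANCE — the blow-down horizon of a rotating wave is AXISYMMETRIC about the precession axis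
# ((J″), eng-4's companion of (J) `ConicalSteadyEulerRigidity` / (J′) `steadyHorizonRigidity` on the PRECESSING stratum)

Support file (`--supports stmt-NavierStokesRegularity-1222`, helper).  Experiment cell `ns-wall-extremal`, width hand
ns-wall-eng-4 g4 (director-ns KEY 01:52:42Z (3)).  0 kit.  Not a sketch `Prop`: a NEW statement in the vocabulary of the sketch
(`IsRotatingWave x₀ Ω V v` unfolded VERBATIM: `v t x = rotZ (Ω * t) (V (rotZ (-(Ω * t)) (x - x₀)))`), of the Literature class
`IsClassicalNSSolutionOn`, and of the horizon card's Theorems-side twin `HorizonTower.IsBlowdownLimit`.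

## Statements

* `Precession.precessingHorizonEquivariance` — let `v` be a rotating wave about the axis `x₀ + ℝe₃` with angular velocity `Ω ≠ 0`
  and profile `V`, which is a classical Navier–Stokes solution (`ν = 1`, no force) on an open set of times `S ∋ 0`.  If the slice
  `v 0 = V(· − x₀)` and the pressure `p 0` have a blow-down limit `(U, P₀)` about `x₀` (`HorizonTower.IsBlowdownLimit (v 0) (p 0) x₀ U P₀`)
  with `U ∈ C²`, `P₀ ∈ C¹` off the origin, then `DU(z)[J z] = J U(z)` for every `z ≠ 0` (`J = rotGen = e₃ × ·`).
* `PrecessingHorizon.rotZ_equivariant_of_fderiv_rotGen` — infinitesimal axisymmetry off the origin integrates to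
  `U (R_θ z) = R_θ (U z)` (`θ ∈ ℝ`, `z ≠ 0`) for `U ∈ C¹(ℝ³ ∖ {0})`.
* `Precession.precessingHorizonAxisymmetric` — hence the horizon of a precessing state is axisymmetric about the precession axis,
  and its radial part `⟪U, y⟫` is ZONAL: `⟪U (R_θ z), R_θ z⟫ = ⟪U z, z⟫`.

READING.  (J′): on the STEADY stratum every homogeneous `C²` horizon (log-free pressure) is CONSTANT.  (J″): on the PRECESSING
stratum (`Ω ≠ 0`, fast or slow) every `C²` horizon is AXISYMMETRIC about the precession axis — no homogeneity of `U`, no horizon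
laws `𝔏₁`, `𝔏₂` (the conclusion shape of the conjecture `HorizonTowerZonality`, here from time-periodicity alone).  Information-grade
(far field of hypothetical slowly precessing counterexamples; `SlowPrecessionPoloidalLiouville`, 1222 and NS regularity OPEN).

## Proof

`∂ₜv(0, x) = Ω (J V₀(x) − DV₀(x)[J (x − x₀)])` for the slice `V₀ = v 0` (product rule through the rotating frame,
`PrecessingHorizon.hasDerivAt_rotZ_mul_apply`, from `rotZ_eq_cos_sin` and `hasDerivAt_rotZ_zero` of the tree).  In the blow-down
variables `Vₖ z = V₀ (x₀ + λₖ z)`, `pₖ z = p 0 (x₀ + λₖ z) − cₖ` the momentum equation at `(0, x₀ + λₖ z)` reads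
`Ω (J Vₖ z − DVₖ(z)[J z]) = −λₖ⁻¹ (DVₖ(z)[Vₖ z] + ∇pₖ z) + λₖ⁻² ΔVₖ(z)`
(`J (λ z) = λ J z`; chain rule `DVₖ = λₖ DV₀`, `ΔVₖ = λₖ² ΔV₀`, `∇pₖ = λₖ ∇p₀` at `x₀ + λₖ z`).  Testing the blow-down convergence on
the compact `{z}` (orders `0, 1, 2`) gives `Vₖ z → U z`, `DVₖ(z) → DU(z)`, `∇pₖ(z) → ∇P₀(z)`, `ΔVₖ(z) → ΔU(z)`; the right side
tends to `0`, the left to `Ω (J U z − DU(z)[J z])`, whence the claim for `Ω ≠ 0`.  The integration to finite rotations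
differentiates `θ ↦ R_{−θ} U(R_θ z)` (zero derivative at every `θ₀`, by the group law and the hypothesis at `R_{θ₀} z`).

References: planner ns-idea-15, `Cruxes/PoloidalLiouville/PrecessionSketch.lean` (`IsRotatingWave` l.108, (J) l.235),
`…/HorizonTowerSketch.lean` (`IsBlowdownLimit`, `HorizonTowerZonality`); Koch–Nadirashvili–Seregin–Šverák, Acta Math. 203 (2009) §1
(rotations `R_θ`, axisymmetry) [KochNadirashviliSereginSverak2009]. -/

-- the summit and its single problem share the name (D-0017 nested layout)
set_option linter.dupNamespace false

noncomputable section
namespace Summit.NavierStokesRegularity.NavierStokesRegularity.Theorems.PoloidalLiouville.Precession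

open Set Function Filter Topology Metric
open scoped Topology RealInnerProductSpace Laplacian ContDiff
open Literature.Analysis.FluidPDE
open Summit.NavierStokesRegularity.NavierStokesRegularity.Theorems.PoloidalLiouville.HorizonTower (E3)

namespace PrecessingHorizon
/-- The axial part `(0, 0, x₂)` of `x` is `x₂ • e₃`. -/
theorem toLp_axial (x : E3) :
    (WithLp.toLp 2 ![0, 0, x 2] : E3) = (x 2) • EuclideanSpace.single (2 : Fin 3) (1 : ℝ) := by
  ext i
  fin_cases i <;> simp

/-- The horizontal part `(x₀, x₁, 0)` of `x` is `x − x₂ • e₃`. -/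
theorem toLp_horizontal (x : E3) :
    (WithLp.toLp 2 ![x 0, x 1, 0] : E3) = x - (x 2) • EuclideanSpace.single (2 : Fin 3) (1 : ℝ) := by
  ext i
  fin_cases i <;> simp

/-- **Product rule through a rotating frame at `t = 0`**: for `W` with derivative `W'` at `0`,
`d/dt|₀ R_{Ωt} W(t) = Ω J W(0) + W'` (`J = rotGen` the rotation generator). -/
theorem hasDerivAt_rotZ_mul_apply {W : ℝ → E3} {W' : E3} {Ω : ℝ} (hW : HasDerivAt W W' 0) :
    HasDerivAt (fun t => rotZ (Ω * t) (W t)) (Ω • rotGen (W 0) + W') 0 := by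
  set e₃ : E3 := EuclideanSpace.single (2 : Fin 3) (1 : ℝ) with he₃
  -- `R_θ w = cos θ • (w − w₂ e₃) + sin θ • J w + w₂ e₃`
  have hdec : (fun t => rotZ (Ω * t) (W t))
      = fun t => Real.cos (Ω * t) • (W t - (W t 2) • e₃) + Real.sin (Ω * t) • rotGen (W t) + (W t 2) • e₃ := by
    funext t
    rw [rotZ_eq_cos_sin, toLp_horizontal, toLp_axial]
  rw [hdec]
  -- the pieces
  have h2 : HasDerivAt (fun t => W t 2) (W' 2) 0 := by
    have := (EuclideanSpace.proj (2 : Fin 3) : E3 →L[ℝ] ℝ).hasFDerivAt.comp_hasDerivAt (0 : ℝ) hW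
    simpa [Function.comp_def] using this
  have hA : HasDerivAt (fun t => W t - (W t 2) • e₃) (W' - (W' 2) • e₃) 0 := hW.sub (h2.smul_const e₃)
  have hB : HasDerivAt (fun t => rotGen (W t)) (rotGen W') 0 := by
    have := rotGenL.hasFDerivAt.comp_hasDerivAt (0 : ℝ) hW
    simpa [Function.comp_def] using this
  have hC : HasDerivAt (fun t => (W t 2) • e₃) ((W' 2) • e₃) 0 := h2.smul_const e₃
  have hcos : HasDerivAt (fun t => Real.cos (Ω * t)) 0 0 := by
    have := (Real.hasDerivAt_cos (Ω * 0)).comp (0 : ℝ) ((hasDerivAt_id (0 : ℝ)).const_mul Ω)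
    simpa [Function.comp_def] using this
  have hsin : HasDerivAt (fun t => Real.sin (Ω * t)) Ω 0 := by
    have := (Real.hasDerivAt_sin (Ω * 0)).comp (0 : ℝ) ((hasDerivAt_id (0 : ℝ)).const_mul Ω)
    simpa [Function.comp_def] using this
  have h := ((hcos.smul hA).add (hsin.smul hB)).add hC
  refine h.congr_deriv ?_
  simp only [mul_zero, Real.sin_zero, Real.cos_zero, zero_smul, add_zero, one_smul, zero_add]
  abel

end PrecessingHorizon
/-- **(J″) PRECESSING HORIZON EQUIVARIANCE.**  Let `v` be a ROTATING WAVE about the axis through `x₀` parallel to `e₃` with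
angular velocity `Ω ≠ 0` and profile `V` — `v t x = R_{Ωt} V (R_{−Ωt} (x − x₀))`, the body of the sketch's `IsRotatingWave x₀ Ω V v`
— which is a classical Navier–Stokes solution (`ν = 1`, no force) on an open set of times containing `0`.  If the slice `v 0`
(`= V (· − x₀)`) and the pressure `p 0` have a blow-down limit `(U, P₀)` about `x₀` in the sense of `HorizonTower.IsBlowdownLimit`,
with `U ∈ C²` and `P₀ ∈ C¹` off the origin, then the horizon profile is INFINITESIMALLY AXISYMMETRIC about the precession axis:
`DU(z)[J z] = J U(z)` for every `z ≠ 0` (`J = rotGen`, the rotation generator `e₃ × ·`).  Mechanism: in the rescaled equation at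
`xₖ = x₀ + λₖ z` the time derivative `∂ₜv(0, xₖ) = Ω (J Vₖ(z) − DVₖ(z)[J z])` is the only term of order `λₖ⁰`; the inertial,
pressure and viscous terms are `O(λₖ⁻¹)`, `O(λₖ⁻¹)`, `O(λₖ⁻²)` in the blow-down variables.  No homogeneity of `U` is needed. -/
theorem precessingHorizonEquivariance (v : ℝ → E3 → E3) (p : ℝ → E3 → ℝ) (x₀ : E3) (Ω : ℝ) (V U : E3 → E3)
    (P₀ : E3 → ℝ) (S : Set ℝ) (hS : IsOpen S) (h0S : (0 : ℝ) ∈ S) (hNS : IsClassicalNSSolutionOn S 1 0 v p)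
    (hrw : ∀ t x, v t x = rotZ (Ω * t) (V (rotZ (-(Ω * t)) (x - x₀)))) (hΩ : Ω ≠ 0)
    (hU : ContDiffOn ℝ 2 U {0}ᶜ) (hP : ContDiffOn ℝ 1 P₀ {0}ᶜ)
    (hbd : HorizonTower.IsBlowdownLimit (v 0) (p 0) x₀ U P₀) :
    ∀ z : E3, z ≠ 0 → fderiv ℝ U z (rotGen z) = rotGen (U z) := by
  obtain ⟨lam, c, hlam, hlimV, hlimP⟩ := hbd
  have hopen : IsOpen ({0}ᶜ : Set E3) := isOpen_compl_singleton
  /- the slice and its pressure at `t = 0` -/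
  set W₀ : E3 → E3 := v 0 with hW₀
  set q₀ : E3 → ℝ := p 0 with hq₀
  have hinS : ∀ x : E3, ((0 : ℝ), x) ∈ S ×ˢ (univ : Set E3) := fun x => ⟨h0S, mem_univ _⟩
  have hV2 : ContDiff ℝ 2 W₀ := by
    have h := hNS.smooth_velocity.comp_contDiff (contDiff_const.prodMk contDiff_id) hinS
    exact h.of_le (by norm_cast)
  have hp1 : ContDiff ℝ 1 q₀ := by
    have h := hNS.smooth_pressure.comp_contDiff (contDiff_const.prodMk contDiff_id) hinS
    exact h.of_le (by norm_cast)
  -- the profile is the translated slice: `V y = v 0 (x₀ + y)`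
  have hVW : ∀ y : E3, V y = W₀ (x₀ + y) := by
    intro y
    have h := hrw 0 (x₀ + y)
    rw [mul_zero, neg_zero, rotZ_zero, add_sub_cancel_left, rotZ_zero] at h
    exact h.symm
  have hVd : ∀ x, DifferentiableAt ℝ W₀ x := fun x => hV2.differentiable (by norm_cast) x
  have hDVd : ∀ x, DifferentiableAt ℝ (fderiv ℝ W₀) x := fun x =>
    (hV2.fderiv_right (m := 1) (by norm_cast)).differentiable (by simp) x
  have hpd : ∀ x, DifferentiableAt ℝ q₀ x := fun x => hp1.differentiable (by simp) x
  -- the limit `λₖ → ∞`: eventually positive, `λₖ⁻¹ → 0`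
  have hlam_pos : ∀ᶠ k in atTop, 0 < lam k := hlam.eventually_gt_atTop 0
  have hlam_inv : Tendsto (fun k => (lam k)⁻¹) atTop (𝓝 0) := tendsto_inv_atTop_zero.comp hlam
  /- the rescaled fields `Vₖ y = W₀ (x₀ + λₖ y)`, `pₖ y = q₀ (x₀ + λₖ y) − cₖ` and their derivatives -/
  set Vk : ℕ → E3 → E3 := fun k y => W₀ (x₀ + lam k • y) with hVk
  set pk : ℕ → E3 → ℝ := fun k y => q₀ (x₀ + lam k • y) - c k with hpk
  have hA : ∀ (k : ℕ) (y : E3), HasFDerivAt (fun z : E3 => x₀ + lam k • z) (lam k • ContinuousLinearMap.id ℝ E3) y :=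
    fun k y => ((hasFDerivAt_id y).const_smul (lam k)).const_add x₀
  have hDVk : ∀ (k : ℕ) (y : E3), HasFDerivAt (Vk k) (lam k • fderiv ℝ W₀ (x₀ + lam k • y)) y := by
    intro k y
    have h := (hVd (x₀ + lam k • y)).hasFDerivAt.comp y (hA k y)
    have e : (fderiv ℝ W₀ (x₀ + lam k • y)).comp (lam k • ContinuousLinearMap.id ℝ E3)
        = lam k • fderiv ℝ W₀ (x₀ + lam k • y) := by
      ext v; simp
    rw [e] at h
    exact h
  have hfVk : ∀ k, fderiv ℝ (Vk k) = fun y => lam k • fderiv ℝ W₀ (x₀ + lam k • y) :=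
    fun k => funext fun y => (hDVk k y).fderiv
  have hDDVk : ∀ (k : ℕ) (y : E3) (e e' : E3),
      fderiv ℝ (fderiv ℝ (Vk k)) y e e' = (lam k * lam k) • fderiv ℝ (fderiv ℝ W₀) (x₀ + lam k • y) e e' := by
    intro k y e e'
    have h1 : HasFDerivAt (fun z : E3 => fderiv ℝ W₀ (x₀ + lam k • z))
        ((fderiv ℝ (fderiv ℝ W₀) (x₀ + lam k • y)).comp (lam k • ContinuousLinearMap.id ℝ E3)) y :=
      (hDVd (x₀ + lam k • y)).hasFDerivAt.comp y (hA k y)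
    have h2 : HasFDerivAt (fderiv ℝ (Vk k))
        (lam k • (fderiv ℝ (fderiv ℝ W₀) (x₀ + lam k • y)).comp (lam k • ContinuousLinearMap.id ℝ E3)) y := by
      rw [hfVk k]; exact h1.const_smul (lam k)
    rw [h2.fderiv]
    simp only [smul_apply, ContinuousLinearMap.comp_apply, ContinuousLinearMap.id_apply, map_smul, smul_smul]
  have hDpk : ∀ (k : ℕ) (y : E3), HasFDerivAt (pk k) (lam k • fderiv ℝ q₀ (x₀ + lam k • y)) y := by
    intro k y
    have h := ((hpd (x₀ + lam k • y)).hasFDerivAt.comp y (hA k y)).sub_const (c k)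
    have e : (fderiv ℝ q₀ (x₀ + lam k • y)).comp (lam k • ContinuousLinearMap.id ℝ E3)
        = lam k • fderiv ℝ q₀ (x₀ + lam k • y) := by
      ext v; simp
    rw [e] at h
    exact h
  -- regularity of the rescaled fields
  have hAC : ∀ k, ContDiff ℝ 2 (fun y : E3 => x₀ + lam k • y) := fun k =>
    contDiff_const.add (contDiff_id.const_smul (lam k))
  have hVkC : ∀ k, ContDiff ℝ 2 (Vk k) := fun k => hV2.comp (hAC k)
  /- pointwise limits at a fixed `z ≠ 0`, read off the blow-down convergence on the compact `{z}` -/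
  have hptV : ∀ z : E3, z ≠ 0 → ∀ j ≤ 6,
      Tendsto (fun k => ‖iteratedFDeriv ℝ j (fun y : E3 => W₀ (x₀ + lam k • y) - U y) z‖) atTop (𝓝 0) := by
    intro z hz j hj
    have h0 : (0 : E3) ∉ ({z} : Set E3) := by
      rw [Set.mem_singleton_iff]; exact fun h => hz h.symm
    have h := hlimV {z} isCompact_singleton h0 j hj
    simpa only [Set.image_singleton, csSup_singleton] using h
  have hptP : ∀ z : E3, z ≠ 0 → ∀ j ≤ 2,
      Tendsto (fun k => ‖iteratedFDeriv ℝ j (fun y : E3 => q₀ (x₀ + lam k • y) - c k - P₀ y) z‖) atTop (𝓝 0) := by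
    intro z hz j hj
    have h0 : (0 : E3) ∉ ({z} : Set E3) := by
      rw [Set.mem_singleton_iff]; exact fun h => hz h.symm
    have h := hlimP {z} isCompact_singleton h0 j hj
    simpa only [Set.image_singleton, csSup_singleton] using h
  -- evaluation `(L, v) ↦ L v` is jointly continuous
  have happly : ∀ {L : ℕ → E3 →L[ℝ] E3} {v : ℕ → E3} {L₀ : E3 →L[ℝ] E3} {v₀ : E3},
      Tendsto L atTop (𝓝 L₀) → Tendsto v atTop (𝓝 v₀) → Tendsto (fun k => L k (v k)) atTop (𝓝 (L₀ v₀)) := by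
    intro L v L₀ v₀ hL hv
    have hc : Continuous fun q : (E3 →L[ℝ] E3) × E3 => q.1 q.2 := isBoundedBilinearMap_apply.continuous
    exact (hc.tendsto (L₀, v₀)).comp (hL.prodMk_nhds hv)
  -- the standard frame
  set e : OrthonormalBasis (Fin 3) ℝ E3 := EuclideanSpace.basisFun (Fin 3) ℝ with he
  have he1 : ∀ i, ‖e i‖ = 1 := fun i => e.orthonormal.1 i
  /- the three limit statements at `z ≠ 0`: values, first derivatives, Laplacians -/
  have hL0 : ∀ z : E3, z ≠ 0 → Tendsto (fun k => Vk k z) atTop (𝓝 (U z)) := by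
    intro z hz
    rw [tendsto_iff_norm_sub_tendsto_zero]
    have h := hptV z hz 0 (by norm_num)
    simpa only [norm_iteratedFDeriv_zero] using h
  have hL1 : ∀ z : E3, z ≠ 0 → Tendsto (fun k => fderiv ℝ (Vk k) z) atTop (𝓝 (fderiv ℝ U z)) := by
    intro z hz
    have hUd : DifferentiableAt ℝ U z := ((hU z hz).contDiffAt (hopen.mem_nhds hz)).differentiableAt (by norm_num)
    rw [tendsto_iff_norm_sub_tendsto_zero]
    have h := hptV z hz 1 (by norm_num)
    refine h.congr fun k => ?_
    rw [← norm_iteratedFDeriv_fderiv, norm_iteratedFDeriv_zero,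
      fderiv_fun_sub ((hDVk k z).differentiableAt) hUd]
  have hLP : ∀ z : E3, z ≠ 0 → Tendsto (fun k => gradient (pk k) z) atTop (𝓝 (gradient P₀ z)) := by
    intro z hz
    have hPd : DifferentiableAt ℝ P₀ z := ((hP z hz).contDiffAt (hopen.mem_nhds hz)).differentiableAt (by norm_num)
    rw [tendsto_iff_norm_sub_tendsto_zero]
    have h := hptP z hz 1 (by norm_num)
    refine h.congr fun k => ?_
    rw [← norm_iteratedFDeriv_fderiv, norm_iteratedFDeriv_zero,
      fderiv_fun_sub ((hDpk k z).differentiableAt) hPd, gradient, gradient, ← map_sub, LinearIsometryEquiv.norm_map]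
  -- Laplacians through the frame: `Δ f z = ∑ᵢ D²f(z)[eᵢ, eᵢ]`
  have hΔ : ∀ (f : E3 → E3) (z : E3), (Δ f) z = ∑ i, fderiv ℝ (fderiv ℝ f) z (e i) (e i) := by
    intro f z
    rw [InnerProductSpace.laplacian_eq_iteratedFDeriv_orthonormalBasis f e]
    exact Finset.sum_congr rfl fun i _ => by rw [iteratedFDeriv_two_apply]; rfl
  have hL2 : ∀ z : E3, z ≠ 0 → Tendsto (fun k => (Δ (Vk k)) z) atTop (𝓝 ((Δ U) z)) := by
    intro z hz
    have hU2z : ContDiffAt ℝ 2 U z := (hU z hz).contDiffAt (hopen.mem_nhds hz)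
    simp only [hΔ]
    refine tendsto_finsetSum _ fun i _ => ?_
    rw [tendsto_iff_norm_sub_tendsto_zero]
    have h := hptV z hz 2 (by norm_num)
    refine squeeze_zero (fun k => norm_nonneg _) (fun k => ?_) h
    have hsub : iteratedFDeriv ℝ 2 (fun y : E3 => W₀ (x₀ + lam k • y) - U y) z
        = iteratedFDeriv ℝ 2 (Vk k) z - iteratedFDeriv ℝ 2 U z := by
      have : (fun y : E3 => W₀ (x₀ + lam k • y) - U y) = Vk k - U := rfl
      rw [this, iteratedFDeriv_sub_apply ((hVkC k).contDiffAt) hU2z]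
    have happ : fderiv ℝ (fderiv ℝ (Vk k)) z (e i) (e i) - fderiv ℝ (fderiv ℝ U) z (e i) (e i)
        = (iteratedFDeriv ℝ 2 (fun y : E3 => W₀ (x₀ + lam k • y) - U y) z) ![e i, e i] := by
      rw [hsub, sub_apply, iteratedFDeriv_two_apply, iteratedFDeriv_two_apply]
      rfl
    rw [happ]
    calc ‖(iteratedFDeriv ℝ 2 (fun y : E3 => W₀ (x₀ + lam k • y) - U y) z) ![e i, e i]‖
        ≤ ‖iteratedFDeriv ℝ 2 (fun y : E3 => W₀ (x₀ + lam k • y) - U y) z‖ * ∏ j, ‖(![e i, e i] : Fin 2 → E3) j‖ :=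
          ContinuousMultilinearMap.le_opNorm _ _
      _ = ‖iteratedFDeriv ℝ 2 (fun y : E3 => W₀ (x₀ + lam k • y) - U y) z‖ := by
          rw [Fin.prod_univ_two]
          simp [he1]
  have hΔVk : ∀ (k : ℕ) (z : E3), (Δ (Vk k)) z = (lam k * lam k) • (Δ W₀) (x₀ + lam k • z) := by
    intro k z
    rw [hΔ, hΔ, Finset.smul_sum]
    exact Finset.sum_congr rfl fun i _ => hDDVk k z (e i) (e i)
  /- the time derivative of the rotating wave at `t = 0`: `∂ₜv(0, x) = Ω (J W₀(x) − DW₀(x)[J (x − x₀)])` -/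
  have hdt : ∀ x : E3, timeDerivWithin S v 0 x = Ω • (rotGen (W₀ x) - fderiv ℝ W₀ x (rotGen (x - x₀))) := by
    intro x
    rw [timeDerivWithin, derivWithin_of_isOpen hS h0S]
    have hin : HasDerivAt (fun t : ℝ => rotZ ((-Ω) * t) (x - x₀)) ((-Ω) • rotGen (x - x₀) + 0) 0 :=
      PrecessingHorizon.hasDerivAt_rotZ_mul_apply (W := fun _ => x - x₀) (hasDerivAt_const (0 : ℝ) (x - x₀))
    have hV' : HasFDerivAt V (fderiv ℝ W₀ x) (rotZ ((-Ω) * 0) (x - x₀)) := by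
      rw [mul_zero, rotZ_zero]
      have hVf : V = fun y => W₀ (x₀ + y) := funext hVW
      rw [hVf]
      have h := (hVd (x₀ + (x - x₀))).hasFDerivAt.comp (x - x₀) ((hasFDerivAt_id (x - x₀)).const_add x₀)
      rw [add_sub_cancel] at h
      simpa [Function.comp_def] using h
    have hWt : HasDerivAt (fun t : ℝ => V (rotZ ((-Ω) * t) (x - x₀))) (fderiv ℝ W₀ x ((-Ω) • rotGen (x - x₀) + 0)) 0 :=
      hV'.comp_hasDerivAt (0 : ℝ) hin
    have hout := PrecessingHorizon.hasDerivAt_rotZ_mul_apply (Ω := Ω) hWt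
    have hfun : (fun s => v s x) = fun t => rotZ (Ω * t) (V (rotZ ((-Ω) * t) (x - x₀))) := by
      funext t; rw [hrw t x, neg_mul]
    rw [hfun, hout.deriv, mul_zero, rotZ_zero, hVW, add_sub_cancel, add_zero, map_smul, smul_sub, neg_smul,
      ← sub_eq_add_neg]
  /- the rescaled equation: `Ω (J Vₖ z − DVₖ(z)[J z]) = −λₖ⁻¹ (DVₖ(z)[Vₖ z] + ∇pₖ z) + λₖ⁻¹ (λₖ⁻¹ ΔVₖ z)` -/
  have hEqk : ∀ z : E3, ∀ᶠ k in atTop,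
      Ω • (rotGen (Vk k z) - fderiv ℝ (Vk k) z (rotGen z))
        = -((lam k)⁻¹ • (fderiv ℝ (Vk k) z (Vk k z) + gradient (pk k) z)) + (lam k)⁻¹ • ((lam k)⁻¹ • (Δ (Vk k)) z) := by
    intro z
    filter_upwards [hlam_pos] with k hk
    have hx := hNS.momentum 0 h0S (x₀ + lam k • z)
    rw [hdt, convect, one_smul, Pi.zero_apply, Pi.zero_apply, add_zero, add_sub_cancel_left, rotGen_smul] at hx
    have hgrad : gradient (pk k) z = lam k • gradient q₀ (x₀ + lam k • z) := by
      rw [gradient, (hDpk k z).fderiv, map_smul, gradient]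
    rw [(hDVk k z).fderiv, hgrad, hΔVk, smul_apply, smul_apply]
    rw [map_smul] at hx
    -- `hx : Ω • (J W₀ xₖ − λ • DW₀ xₖ (J z)) + DW₀ xₖ (W₀ xₖ) = ΔW₀ xₖ − ∇q₀ xₖ`
    have hVkz : Vk k z = W₀ (x₀ + lam k • z) := rfl
    rw [hVkz]
    have e1 : (lam k)⁻¹ • (lam k • (fderiv ℝ W₀ (x₀ + lam k • z)) (W₀ (x₀ + lam k • z)) + lam k • gradient q₀ (x₀ + lam k • z))
        = (fderiv ℝ W₀ (x₀ + lam k • z)) (W₀ (x₀ + lam k • z)) + gradient q₀ (x₀ + lam k • z) := by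
      rw [← smul_add, smul_smul, inv_mul_cancel₀ hk.ne', one_smul]
    have e2 : (lam k)⁻¹ • ((lam k)⁻¹ • ((lam k * lam k) • (Δ W₀) (x₀ + lam k • z))) = (Δ W₀) (x₀ + lam k • z) := by
      rw [smul_smul, smul_smul]
      rw [show (lam k)⁻¹ * (lam k)⁻¹ * (lam k * lam k) = 1 by field_simp, one_smul]
    rw [e1, e2]
    rw [← sub_eq_zero] at hx ⊢
    rw [← hx]
    abel
  /- pass to the limit -/
  intro z hz
  have hlhs : Tendsto (fun k => Ω • (rotGen (Vk k z) - fderiv ℝ (Vk k) z (rotGen z))) atTop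
      (𝓝 (Ω • (rotGen (U z) - fderiv ℝ U z (rotGen z)))) := by
    have hJ : Tendsto (fun k => rotGen (Vk k z)) atTop (𝓝 (rotGen (U z))) :=
      (rotGenL.continuous.tendsto _).comp (hL0 z hz)
    exact ((hJ.sub (happly (hL1 z hz) tendsto_const_nhds)).const_smul Ω)
  have hrhs : Tendsto (fun k => -((lam k)⁻¹ • (fderiv ℝ (Vk k) z (Vk k z) + gradient (pk k) z))
      + (lam k)⁻¹ • ((lam k)⁻¹ • (Δ (Vk k)) z)) atTop (𝓝 0) := by
    have h1 : Tendsto (fun k => (lam k)⁻¹ • (fderiv ℝ (Vk k) z (Vk k z) + gradient (pk k) z)) atTop (𝓝 0) := by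
      have h := hlam_inv.smul ((happly (hL1 z hz) (hL0 z hz)).add (hLP z hz))
      rwa [zero_smul] at h
    have h2 : Tendsto (fun k => (lam k)⁻¹ • ((lam k)⁻¹ • (Δ (Vk k)) z)) atTop (𝓝 0) := by
      have h := hlam_inv.smul (hlam_inv.smul (hL2 z hz))
      simpa only [zero_smul] using h
    have h := h1.neg.add h2
    rwa [neg_zero, add_zero] at h
  have hlim := tendsto_nhds_unique (hlhs.congr' (hEqk z)) hrhs
  rw [smul_eq_zero] at hlim
  rcases hlim with hΩ0 | hsub
  · exact absurd hΩ0 hΩ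
  · exact (sub_eq_zero.mp hsub).symm


/-- **Finite rotations from infinitesimal ones.**  If `U ∈ C¹(ℝ³ ∖ {0})` satisfies `DU(z)[J z] = J U(z)` for all `z ≠ 0`
(`J = rotGen`), then `U (R_θ z) = R_θ (U z)` for every angle `θ` and every `z ≠ 0`: the curve
`θ ↦ R_{−θ} U(R_θ z)` has zero derivative (product rule through the rotating frame + the hypothesis at `R_θ z`). -/
theorem PrecessingHorizon.rotZ_equivariant_of_fderiv_rotGen {U : E3 → E3} (hU : ContDiffOn ℝ 1 U {0}ᶜ)
    (h : ∀ z : E3, z ≠ 0 → fderiv ℝ U z (rotGen z) = rotGen (U z)) (θ : ℝ) {z : E3} (hz : z ≠ 0) :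
    U (rotZ θ z) = rotZ θ (U z) := by
  have hrot0 : ∀ (α : ℝ) (w : E3), w ≠ 0 → rotZ α w ≠ 0 := by
    intro α w hw h0
    apply hw
    have hn := norm_rotZ α w
    rw [h0, norm_zero] at hn
    exact norm_eq_zero.mp hn.symm
  have hUd : ∀ w : E3, w ≠ 0 → DifferentiableAt ℝ U w := fun w hw =>
    ((hU w hw).contDiffAt (isOpen_compl_singleton.mem_nhds hw)).differentiableAt (by simp)
  -- the model curve `ψ_w(s) = R_{−s} U(R_s w)` is stationary at `s = 0`
  have hψ : ∀ w : E3, w ≠ 0 → HasDerivAt (fun s : ℝ => rotZ ((-1 : ℝ) * s) (U (rotZ s w))) 0 0 := by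
    intro w hw
    have hU' : HasFDerivAt U (fderiv ℝ U w) (rotZ 0 w) := by rw [rotZ_zero]; exact (hUd w hw).hasFDerivAt
    have hin : HasDerivAt (fun s : ℝ => U (rotZ s w)) (fderiv ℝ U w (rotGen w)) 0 :=
      hU'.comp_hasDerivAt (0 : ℝ) (hasDerivAt_rotZ_zero w)
    have hout := PrecessingHorizon.hasDerivAt_rotZ_mul_apply (Ω := -1) hin
    rw [rotZ_zero, h w hw, neg_one_smul, neg_add_cancel] at hout
    exact hout
  -- the curve `φ(θ) = R_{−θ} U(R_θ z)` has zero derivative at every `θ₀`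
  set φ : ℝ → E3 := fun α => rotZ (-α) (U (rotZ α z)) with hφ
  have hderiv : ∀ θ₀ : ℝ, HasDerivAt φ 0 θ₀ := by
    intro θ₀
    have hw : rotZ θ₀ z ≠ 0 := hrot0 θ₀ z hz
    have h1 : HasDerivAt (fun α : ℝ => rotZ ((-1 : ℝ) * (α - θ₀)) (U (rotZ (α - θ₀) (rotZ θ₀ z)))) 0 θ₀ := by
      have h0 : HasDerivAt (fun s : ℝ => rotZ ((-1 : ℝ) * s) (U (rotZ s (rotZ θ₀ z)))) 0 (θ₀ - θ₀) := by
        rw [sub_self]; exact hψ (rotZ θ₀ z) hw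
      exact HasDerivAt.comp_sub_const θ₀ θ₀ h0
    have h2 := (rotZL (-θ₀)).hasFDerivAt.comp_hasDerivAt θ₀ h1
    rw [map_zero] at h2
    refine h2.congr_of_eventuallyEq (Eventually.of_forall fun α => ?_)
    show rotZ (-α) (U (rotZ α z)) = rotZL (-θ₀) (rotZ ((-1 : ℝ) * (α - θ₀)) (U (rotZ (α - θ₀) (rotZ θ₀ z))))
    rw [rotZL_apply, ← rotZ_add, ← rotZ_add]
    congr 1
    · ring
    · congr 2; ring
  have hconst : φ θ = φ 0 :=
    is_const_of_deriv_eq_zero (fun α => (hderiv α).differentiableAt) (fun α => (hderiv α).deriv) θ 0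
  have hφ0 : φ 0 = U z := by simp only [hφ, neg_zero, rotZ_zero]
  have hmain : rotZ (-θ) (U (rotZ θ z)) = U z := by rw [← hφ0]; exact hconst
  calc U (rotZ θ z) = rotZ (θ + -θ) (U (rotZ θ z)) := by rw [add_neg_cancel, rotZ_zero]
    _ = rotZ θ (U z) := by rw [rotZ_add, hmain]

/-- **(J″, integrated form) THE HORIZON OF A PRECESSING STATE IS AXISYMMETRIC ABOUT THE PRECESSION AXIS.**  Under the
hypotheses of `precessingHorizonEquivariance`: `U (R_θ z) = R_θ (U z)` for all `θ` and `z ≠ 0`, and in particular the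
radial part `⟪U, y⟫` of the horizon profile is ZONAL (rotation invariant) — the conclusion shape of the horizon card's
`HorizonTowerZonality`, here on the precessing stratum and without the horizon laws `𝔏₁`, `𝔏₂`. -/
theorem precessingHorizonAxisymmetric (v : ℝ → E3 → E3) (p : ℝ → E3 → ℝ) (x₀ : E3) (Ω : ℝ) (V U : E3 → E3)
    (P₀ : E3 → ℝ) (S : Set ℝ) (hS : IsOpen S) (h0S : (0 : ℝ) ∈ S) (hNS : IsClassicalNSSolutionOn S 1 0 v p)
    (hrw : ∀ t x, v t x = rotZ (Ω * t) (V (rotZ (-(Ω * t)) (x - x₀)))) (hΩ : Ω ≠ 0)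
    (hU : ContDiffOn ℝ 2 U {0}ᶜ) (hP : ContDiffOn ℝ 1 P₀ {0}ᶜ)
    (hbd : HorizonTower.IsBlowdownLimit (v 0) (p 0) x₀ U P₀) :
    (∀ θ : ℝ, ∀ z : E3, z ≠ 0 → U (rotZ θ z) = rotZ θ (U z)) ∧
      ∀ θ : ℝ, ∀ z : E3, z ≠ 0 → inner ℝ (U (rotZ θ z)) (rotZ θ z) = inner ℝ (U z) z := by
  have hinf := precessingHorizonEquivariance v p x₀ Ω V U P₀ S hS h0S hNS hrw hΩ hU hP hbd
  have heq : ∀ θ : ℝ, ∀ z : E3, z ≠ 0 → U (rotZ θ z) = rotZ θ (U z) := fun θ z hz =>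
    PrecessingHorizon.rotZ_equivariant_of_fderiv_rotGen (hU.of_le (by norm_cast)) hinf θ hz
  refine ⟨heq, fun θ z hz => ?_⟩
  rw [heq θ z hz, ← rotZLIE_apply, ← rotZLIE_apply, LinearIsometryEquiv.inner_map_map]

end Summit.NavierStokesRegularity.NavierStokesRegularity.Theorems.PoloidalLiouville.Precession

end
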